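import Literature.Computability.Complexity.DTIMESubsetNTIME
import Literature.Computability.Complexity.LengthCompare
import Literature.Computability.Complexity.PlumbingBricks
import HarnessLib

/-!
# `NP ⊆ NTIME(2ⁿ)` in the tree's verifier form

Literature / complexity toolkit, companion of `DTIMESubsetNTIME.lean` (serves the MCSP-hardness
obstructions, `Barriers/PneNP/MCSPHardnessObstructionsProofs.lean`, where `NP ⊆ NTIME (2 ^ ·)`
enters as a hypothesis, and the NEXP-versus-NP step of Murray–Williams 2017). The tree's `NP` is
the certificate class `polyExists P` (`Nondeterministic.lean`: `x ∈ L ↔ ∃ y, |y| ≤ p |x| ∧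
⟨x, y⟩ ∈ L'`, `L' ∈ P`), whereas `NTIME t` is the one-constant verifier form; passing from the
former to the latter needs a verifier that CUTS an over-long witness at length `p(|x|) + 1`
(reading the rest two symbols per step: the truncating wrapper `truncMapAux` of
`TruncMapMachine.lean`, here with the polynomial clock `x ↦ ⟨x, 1^{p(|x|)+1}⟩`) and then decides
the polynomial-time language `LenLe p ⊓ L'` ("the kept witness is admissible and accepted";
`LengthCompare.lean`, `StringCopy.inter_mem_P`):

* **`NP_subset_NTIME_two_pow : NP ⊆ NTIME (2 ^ ·)`** (Arora–Barak 2009, Thm. 2.6 / Claim 2.4: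
  `NP = ⋃ₖ NTIME(nᵏ) ⊆ NEXP`; here directly into the member `NTIME(2ⁿ)`).

## References

* S. Arora, B. Barak, *Computational Complexity: A Modern Approach*, CUP 2009, Def. 2.1,
  Thm. 2.6, Claim 2.4, §1.3.
-/

namespace Literature.Computability.Complexity

open _root_.Computability Turing Polynomial Brick Plumb

/-- The polynomial clock `x ↦ ⟨x, 1^{p(|x|)+1}⟩` is computed by some machine in polynomial time.
[folklore] -/
theorem exists_machine_pair_ones (p : Polynomial ℕ) :
    ∃ (q : Polynomial ℕ) (N : TM2ComputableAux Bool Bool),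
      ∀ x : List Bool, N.OutputsWithin x (boolPair x (ones (p.eval x.length + 1))) (q.eval x.length) := by
  have h : fanoutFn id (polyFn (p + 1)) ∈ FP :=
    fanoutFn_mem_FP OracleCompose.id_mem_FP (polyFn_mem_FP _)
  obtain ⟨q, N, hN⟩ := h
  refine ⟨q, N, fun x => ?_⟩
  have := hN x
  simpa [fanoutFn_apply] using this

/-- **`NP ⊆ NTIME(2ⁿ)`** (Arora–Barak 2009, Thm. 2.6 with Claim 2.4, in the tree's one-constant
verifier form of `NTIME`). For `L ∈ NP` presented by `L' ∈ P` and the witness polynomial `p`,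
the verifier on `⟨x, y⟩` is the truncating wrapper `truncMapAux` (`TruncMapMachine.lean`) for
the clock `x ↦ ⟨x, 1^{p(|x|)+1}⟩` — output `⟨x, y ↾ (p(|x|) + 1)⟩` within `poly(|x|) + |y| / 2`
steps — followed by a polynomial-time decider of `LenLe p ⊓ L'`; the relation
"`y ↾ (p(|x|)+1)` is admissible (`≤ p |x|`) and `⟨x, y ↾ (p(|x|)+1)⟩ ∈ L'`" has exactly the
`NP`-witnesses of `x` as witnesses, and all bounds are `O(2ⁿ) + |y| / 2`.
[cite: AroraBarak2009, Thm. 2.6] -/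
theorem NP_subset_NTIME_two_pow : Nondeterministic.NP ⊆ NTIME (fun n => 2 ^ n) := by
  rintro L ⟨L', hL'P, p, hL⟩
  -- a decider of `LenLe p ⊓ L'`
  have hL'' : LenLe p ⊓ L' ∈ Classes.P := inter_mem_P (LenLe_mem_P p) hL'P
  simp only [Classes.P, Set.mem_iUnion] at hL''
  obtain ⟨k, a, hdec⟩ := hL''
  obtain ⟨M, hM⟩ := (hdec : TimeDecidable id (LenLe p ⊓ L') fun n => a * n ^ k + a)
  -- the clock and the domination constant
  obtain ⟨q, N, hN⟩ := exists_machine_pair_ones p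
  obtain ⟨b, hb⟩ := TimeConstructible.exists_poly_le_two_pow_pow
    (q + 5 * X + 13 + 2 * (p + 1) + (C a * (2 * X + 3 + p) ^ k + C a)) le_rfl
  let V : TM2ComputableAux Bool Bool := (truncMapAux N).comp M
  refine ⟨2 * b + 2,
    fun x y => (LenLe p ⊓ L').boolIndicator (boolPair x (y.take (p.eval x.length + 1))), V,
    fun x y hy => ?_, fun x => ?_⟩
  · -- running time
    have h₁ := outputsWithin_truncMapAux_boolPair N (y := y) (hN x)
    simp only [List.length_replicate] at h₁
    set y' := y.take (p.eval x.length + 1) with hy'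
    have hlen' : y'.length ≤ p.eval x.length + 1 := List.length_take_le _ _
    have h₂ : M.OutputsWithin (boolPair x y') (encodeBool ((LenLe p ⊓ L').boolIndicator
        (boolPair x y'))) (a * (2 * x.length + 3 + p.eval x.length) ^ k + a) := by
      refine (hM (boolPair x y')).mono ?_
      simp only [id, length_boolPair]
      have : 2 * x.length + 2 + y'.length ≤ 2 * x.length + 3 + p.eval x.length := by omega
      exact Nat.add_le_add_right (Nat.mul_le_mul_left a (Nat.pow_le_pow_left this k)) a
    have h := Turing.TM2ComputableAux.comp_outputsWithin _ _ h₁ h₂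
    refine h.mono ?_
    have hbn := hb x.length
    simp only [eval_add, eval_mul, eval_ofNat, eval_X, eval_pow, eval_C, eval_one, pow_one] at hbn
    have hy2 : 2 * (y.length / 2) ≤ (2 * b + 2) * 2 ^ x.length + (2 * b + 2) :=
      (Nat.mul_div_le y.length 2).trans hy
    nlinarith [hbn, hy2]
  · -- correctness
    have hind : ∀ w : List Bool, (LenLe p ⊓ L').boolIndicator w = true ↔ w ∈ LenLe p ∧ w ∈ L' :=
      fun w => (Set.mem_iff_boolIndicator ((LenLe p ⊓ L' : Language Bool) : Set (List Bool)) w).symm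
    rw [hL x]
    constructor
    · rintro ⟨y₀, hy₀, hmem⟩
      refine ⟨y₀, ?_, ?_⟩
      · have hbn := hb x.length
        simp only [eval_add, eval_mul, eval_ofNat, eval_X, eval_pow, eval_C, eval_one,
          pow_one] at hbn
        show y₀.length ≤ (2 * b + 2) * 2 ^ x.length + (2 * b + 2)
        calc y₀.length ≤ p.eval x.length := hy₀
          _ ≤ b * 2 ^ x.length + b := by omega
          _ ≤ (2 * b + 2) * 2 ^ x.length + (2 * b + 2) :=
              Nat.add_le_add (Nat.mul_le_mul_right _ (by omega)) (by omega)
      · rw [hind, List.take_of_length_le (by omega), boolPair_mem_LenLe]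
        exact ⟨hy₀, hmem⟩
    · rintro ⟨y, -, hR⟩
      rw [hind, boolPair_mem_LenLe] at hR
      exact ⟨_, hR.1, hR.2⟩

end Literature.Computability.Complexity
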